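import Mathlib
import HarnessLib
import Summits.Ventures.LatticeQCDFlow.Exactness.NCMCGeneralSpaceLagProductMoments

/-!
# The variance of the known-mean lag sum under a Doeblin POWER, from any start: `E_{μ₀}[(Σ_{t<n} B_t)²] ≤ 4 C_g⁴ (1 + 2k + 2m/ε) n` and `E_{μ₀}[(S⁰_N(k)/(N − k) − C_g(k))²] ≤ 8 C_g⁴ (1 + 2k + 2m/ε + (m/ε)²)/(N − k)`

HONEST FRAMING: exact (Metropolis-corrected) sampling algorithms for lattice gauge theory;
figures of merit are autocorrelation/cost numbers at stated couplings and volumes; no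
continuum-physics claim.

Venture `LatticeQCDFlow` (cell pub-lqcd), topic `Exactness`; FANOUT row 13 (`eng-snf`, GEN-20).
NEW WORK of the cell, not a published result; no definition is introduced; nothing is cited as a
fact (the `L²`-consistency of empirical autocovariances of uniformly mixing sequences — Anderson 1971
Ch. 8 — NAMED ONLY).  Setting and notation of `NCMCGeneralSpaceLagProductMoments.lean`: `κ` Markov with
invariant probability `π`, `(nHit κ m)(x, ·) ≥ ε ν` (`0 < ε ≤ 1`, `0 < m`, `e = ε.toReal`), `P_{μ₀}` the
path law from ANY initial law, `|g| ≤ C_g` measurable, `A_t = g(X_t) g(X_{t+k})`,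
`B_t = A_t − E_{μ₀} A_t`, `C_g(k) = Scoring.autocov κ π g k`, `S⁰_N(k) = Σ_{t<N−k} A_t` (the known-mean
lag sum; scorer A's `lagSum`).  Summing the covariance envelope
`|E B_s B_t| ≤ 4 C_g⁴ (1 − e)^{⌊(|t−s|−k)/m⌋}` over all pairs with row 8's pair count `Scoring.sum_sum_dist`
gives the variance of the lag sum, linear in the number of terms with slope `4 C_g⁴ (1 + 2k + 2m/e)`;
adding the squared bias (`Σ_t 2 C_g² (1 − e)^{⌊t/m⌋} ≤ 2 C_g² m/e`) gives the mean-square error of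
`S⁰_N(k)/(N − k)` about `C_g(k)`, of order `(k + 1)/(N − k)` UNIFORMLY IN THE INITIAL LAW — the known-mean
half of the consistency of scorer A's Γ-method estimator (`NCMCGeneralSpaceGammaMethodConsistency.lean`
replaces the known mean by the sample mean).

## Content (hypotheses as above; every `μ₀`)

* `sum_range_pow_sub_div_le` — `Σ_{t<n} x^{⌊(t+1−k)/m⌋} ≤ k + m/(1 − x)`;
* **`chain_sq_sum_lagProduct_centred_le_of_nHit`** — `E_{μ₀}[(Σ_{t<n} B_t)²] ≤ 4 C_g⁴ (1 + 2k + 2m/e) n`;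
* **`chain_mse_lagSum_div_le_of_nHit`** — for `k < N`:
  `E_{μ₀}[(S⁰_N(k)/(N − k) − C_g(k))²] ≤ 8 C_g⁴ (1 + 2k + 2m/e + (m/e)²)/(N − k)`.

NOT CLAIMED: sharp constants; unbounded observables; anything about a concrete sampler's `ε`.
-/

namespace Summit.Ventures.LatticeQCDFlow.Exactness.GeneralNCMC

open MeasureTheory ProbabilityTheory Set Filter Finset
open scoped ENNReal Topology

variable {S : Type*} [MeasurableSpace S]

section LagSum

variable {κ : Kernel S S} [IsMarkovKernel κ] {ν : Measure S} [IsProbabilityMeasure ν] {ε : ℝ≥0∞}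
  {π : Measure S} [IsProbabilityMeasure π] {m : ℕ} (μ₀ : Measure S) [IsProbabilityMeasure μ₀]

/-- `Σ_{t<n} x^{⌊(t+1−k)/m⌋} ≤ k + m/(1 − x)` (`0 ≤ x < 1`, `0 < m`; natural subtraction). -/
theorem sum_range_pow_sub_div_le {x : ℝ} (hm : 0 < m) (hx0 : 0 ≤ x) (hx1 : x < 1) (k n : ℕ) :
    ∑ t ∈ range n, x ^ ((t + 1 - k) / m) ≤ k + m / (1 - x) := by
  have hx1' : x ≤ 1 := hx1.le
  calc ∑ t ∈ range n, x ^ ((t + 1 - k) / m)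
      ≤ ∑ t ∈ range (k + n), x ^ ((t + 1 - k) / m) :=
        Finset.sum_le_sum_of_subset_of_nonneg (Finset.range_subset_range.2 (Nat.le_add_left n k))
          fun t _ _ => pow_nonneg hx0 _
    _ = ∑ t ∈ range k, x ^ ((t + 1 - k) / m) + ∑ t ∈ range n, x ^ ((k + t + 1 - k) / m) := by
        rw [Finset.sum_range_add]
    _ ≤ ∑ t ∈ range k, (1 : ℝ) + ∑ t ∈ range n, x ^ (t / m) := by
        refine add_le_add (Finset.sum_le_sum fun t _ => pow_le_one₀ hx0 hx1')
          (Finset.sum_le_sum fun t _ => pow_le_pow_of_le_one hx0 hx1' ?_)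
        exact Nat.div_le_div_right (by omega)
    _ ≤ k + m / (1 - x) := by
        rw [Finset.sum_const, Finset.card_range, nsmul_eq_mul, mul_one]
        exact add_le_add le_rfl (Scoring.sum_range_pow_div_le hm hx0 hx1 n)

/-- **SECOND MOMENT OF THE CENTRED LAG SUM FROM ANY START**: with `B_t = g(X_t)g(X_{t+k}) −
E_{μ₀}[g(X_t)g(X_{t+k})]`, `E_{μ₀}[(Σ_{t<n} B_t)²] ≤ 4 C_g⁴ (1 + 2k + 2m/ε) n` (`0 < ε ≤ 1`, `0 < m`). -/
theorem chain_sq_sum_lagProduct_centred_le_of_nHit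
    (hmin : ∀ x {B : Set S}, MeasurableSet B → ε * ν B ≤ nHit κ m x B) (hε0 : 0 < ε) (hε1 : ε ≤ 1)
    (hm : 0 < m) (hπ : Kernel.Invariant κ π) {g : S → ℝ} (hg : Measurable g) {Cg : ℝ}
    (hCg : ∀ x, |g x| ≤ Cg) (k n : ℕ) :
    ∫ x, (∑ t ∈ range n, (g (x t) * g (x (t + k)) - ∫ x', g (x' t) * g (x' (t + k))
          ∂(Kernel.trajMeasure (X := fun _ : ℕ => S) μ₀
            (fun n : ℕ => κ.comap (fun h : (i : ↥(Finset.Iic n)) → S => h ⟨n, Finset.mem_Iic.2 le_rfl⟩)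
              (measurable_pi_apply _))))) ^ 2
        ∂(Kernel.trajMeasure (X := fun _ : ℕ => S) μ₀
        (fun n : ℕ => κ.comap (fun h : (i : ↥(Finset.Iic n)) → S => h ⟨n, Finset.mem_Iic.2 le_rfl⟩)
          (measurable_pi_apply _)))
      ≤ 4 * Cg ^ 4 * (1 + 2 * k + 2 * m / ε.toReal) * n := by
  set P := Kernel.trajMeasure (X := fun _ : ℕ => S) μ₀
      (fun n : ℕ => κ.comap (fun h : (i : ↥(Finset.Iic n)) → S => h ⟨n, Finset.mem_Iic.2 le_rfl⟩)
        (measurable_pi_apply _)) with hP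
  have hεtop : ε ≠ ∞ := ne_top_of_le_ne_top ENNReal.one_ne_top hε1
  have hεpos : 0 < ε.toReal := ENNReal.toReal_pos hε0.ne' hεtop
  have hr0 : 0 ≤ 1 - ε.toReal :=
    sub_nonneg.2 (ENNReal.toReal_le_of_le_ofReal zero_le_one (by simpa using hε1))
  have hr1 : 1 - ε.toReal < 1 := sub_lt_self _ hεpos
  have hCg0 : 0 ≤ Cg := (abs_nonneg _).trans (hCg (Classical.choice
    (nonempty_of_isProbabilityMeasure μ₀)))
  -- abbreviate the centred products
  set B : ℕ → (ℕ → S) → ℝ := fun u x =>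
    g (x u) * g (x (u + k)) - ∫ x', g (x' u) * g (x' (u + k)) ∂P with hB
  have hAb : ∀ u (x : ℕ → S), |g (x u) * g (x (u + k))| ≤ Cg * Cg := fun u x => by
    rw [abs_mul]; exact mul_le_mul (hCg _) (hCg _) (abs_nonneg _) hCg0
  have hEb : ∀ u, |∫ x', g (x' u) * g (x' (u + k)) ∂P| ≤ Cg * Cg := fun u => by
    calc |∫ x', g (x' u) * g (x' (u + k)) ∂P| = ‖∫ x', g (x' u) * g (x' (u + k)) ∂P‖ :=
          (Real.norm_eq_abs _).symm
      _ ≤ Cg * Cg * P.real univ := norm_integral_le_of_norm_le_const (Eventually.of_forall fun x => by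
          rw [Real.norm_eq_abs]; exact hAb u x)
      _ = Cg * Cg := by rw [probReal_univ, mul_one]
  have hBm : ∀ u, Measurable (B u) := fun u =>
    ((hg.comp (measurable_pi_apply _)).mul (hg.comp (measurable_pi_apply _))).sub measurable_const
  have hBb : ∀ u x, |B u x| ≤ 2 * (Cg * Cg) := fun u x =>
    (abs_sub _ _).trans (by linarith [hAb u x, hEb u])
  have hint : ∀ i j, Integrable (fun x => B i x * B j x) P := fun i j =>
    Scoring.integrable_of_bounded P ((hBm i).mul (hBm j)) (C := 2 * (Cg * Cg) * (2 * (Cg * Cg)))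
      fun x => by rw [abs_mul]; exact mul_le_mul (hBb i x) (hBb j x) (abs_nonneg _) (by positivity)
  show ∫ x, (∑ t ∈ range n, B t x) ^ 2 ∂P ≤ _
  have hexp : ∫ x, (∑ t ∈ range n, B t x) ^ 2 ∂P
      = ∑ i ∈ range n, ∑ j ∈ range n, ∫ x, B i x * B j x ∂P := by
    have hpt : ∀ x : ℕ → S, (∑ t ∈ range n, B t x) ^ 2
        = ∑ i ∈ range n, ∑ j ∈ range n, B i x * B j x := fun x => by
      rw [sq, Finset.sum_mul_sum]
    rw [integral_congr_ae (ae_of_all _ hpt),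
      integral_finsetSum _ fun i _ => integrable_finsetSum _ fun j _ => hint _ _]
    exact Finset.sum_congr rfl fun i _ => integral_finsetSum _ fun j _ => hint _ _
  rw [hexp]
  have hterm : ∀ i ∈ range n, ∀ j ∈ range n,
      ∫ x, B i x * B j x ∂P ≤ 4 * Cg ^ 4 * (1 - ε.toReal) ^ ((Nat.dist i j - k) / m) := by
    intro i _ j _
    refine (le_abs_self _).trans ?_
    have h := abs_chain_lagProduct_cov_le_of_nHit μ₀ hmin hε1 hπ hg hCg k i j
    rw [← hP] at h
    exact h
  calc ∑ i ∈ range n, ∑ j ∈ range n, ∫ x, B i x * B j x ∂P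
      ≤ ∑ i ∈ range n, ∑ j ∈ range n, 4 * Cg ^ 4 * (1 - ε.toReal) ^ ((Nat.dist i j - k) / m) :=
        Finset.sum_le_sum fun i hi => Finset.sum_le_sum fun j hj => hterm i hi j hj
    _ = n * (4 * Cg ^ 4 * (1 - ε.toReal) ^ ((0 - k) / m))
        + 2 * ∑ t ∈ range n, ((n : ℝ) - (t + 1)) * (4 * Cg ^ 4 * (1 - ε.toReal) ^ ((t + 1 - k) / m)) :=
        Scoring.sum_sum_dist (fun d => 4 * Cg ^ 4 * (1 - ε.toReal) ^ ((d - k) / m)) n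
    _ ≤ n * (4 * Cg ^ 4)
        + 2 * ∑ t ∈ range n, (n : ℝ) * (4 * Cg ^ 4 * (1 - ε.toReal) ^ ((t + 1 - k) / m)) := by
        rw [Nat.zero_sub, Nat.zero_div, pow_zero, mul_one]
        refine add_le_add le_rfl (mul_le_mul_of_nonneg_left (Finset.sum_le_sum fun t ht => ?_)
          (by norm_num))
        refine mul_le_mul_of_nonneg_right (by linarith [(Nat.cast_nonneg t : (0 : ℝ) ≤ t)]) ?_
        positivity
    _ = n * (4 * Cg ^ 4) * (1 + 2 * ∑ t ∈ range n, (1 - ε.toReal) ^ ((t + 1 - k) / m)) := by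
        rw [← Finset.mul_sum, ← Finset.mul_sum]; ring
    _ ≤ n * (4 * Cg ^ 4) * (1 + 2 * (k + m / ε.toReal)) := by
        refine mul_le_mul_of_nonneg_left (add_le_add le_rfl (mul_le_mul_of_nonneg_left ?_
          (by norm_num))) (by positivity)
        have h := sum_range_pow_sub_div_le (m := m) hm hr0 hr1 k n
        rwa [sub_sub_cancel] at h
    _ = 4 * Cg ^ 4 * (1 + 2 * k + 2 * m / ε.toReal) * n := by ring

/-- **MEAN-SQUARE ERROR OF THE KNOWN-MEAN LAG AVERAGE FROM ANY START**: for `k < N`, with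
`S⁰_N(k) = Σ_{t<N−k} g(X_t) g(X_{t+k})`,
`E_{μ₀}[(S⁰_N(k)/(N − k) − autocov κ π g k)²] ≤ 8 C_g⁴ (1 + 2k + 2m/ε + (m/ε)²)/(N − k)`. -/
theorem chain_mse_lagSum_div_le_of_nHit
    (hmin : ∀ x {B : Set S}, MeasurableSet B → ε * ν B ≤ nHit κ m x B) (hε0 : 0 < ε) (hε1 : ε ≤ 1)
    (hm : 0 < m) (hπ : Kernel.Invariant κ π) {g : S → ℝ} (hg : Measurable g) {Cg : ℝ}
    (hCg : ∀ x, |g x| ≤ Cg) {k N : ℕ} (hkN : k < N) :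
    ∫ x, ((∑ t ∈ range (N - k), g (x t) * g (x (t + k))) / ((N - k : ℕ) : ℝ)
        - Scoring.autocov κ π g k) ^ 2
        ∂(Kernel.trajMeasure (X := fun _ : ℕ => S) μ₀
        (fun n : ℕ => κ.comap (fun h : (i : ↥(Finset.Iic n)) → S => h ⟨n, Finset.mem_Iic.2 le_rfl⟩)
          (measurable_pi_apply _)))
      ≤ 8 * Cg ^ 4 * (1 + 2 * k + 2 * m / ε.toReal + (m / ε.toReal) ^ 2) / ((N - k : ℕ) : ℝ) := by
  set P := Kernel.trajMeasure (X := fun _ : ℕ => S) μ₀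
      (fun n : ℕ => κ.comap (fun h : (i : ↥(Finset.Iic n)) → S => h ⟨n, Finset.mem_Iic.2 le_rfl⟩)
        (measurable_pi_apply _)) with hP
  have hεtop : ε ≠ ∞ := ne_top_of_le_ne_top ENNReal.one_ne_top hε1
  have hεpos : 0 < ε.toReal := ENNReal.toReal_pos hε0.ne' hεtop
  have hr0 : 0 ≤ 1 - ε.toReal :=
    sub_nonneg.2 (ENNReal.toReal_le_of_le_ofReal zero_le_one (by simpa using hε1))
  have hr1 : 1 - ε.toReal < 1 := sub_lt_self _ hεpos
  have hCg0 : 0 ≤ Cg := (abs_nonneg _).trans (hCg (Classical.choice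
    (nonempty_of_isProbabilityMeasure μ₀)))
  set n := N - k with hn
  have hn0 : 0 < n := by omega
  have hn0' : (0 : ℝ) < n := by exact_mod_cast hn0
  set c := Scoring.autocov κ π g k with hc
  -- the centred products and the deterministic bias
  set E : ℕ → ℝ := fun u => ∫ x', g (x' u) * g (x' (u + k)) ∂P with hE
  set B : ℕ → (ℕ → S) → ℝ := fun u x => g (x u) * g (x (u + k)) - E u with hB
  have hAm : ∀ u, Measurable fun x : ℕ → S => g (x u) * g (x (u + k)) := fun u =>
    (hg.comp (measurable_pi_apply _)).mul (hg.comp (measurable_pi_apply _))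
  have hAb : ∀ u (x : ℕ → S), |g (x u) * g (x (u + k))| ≤ Cg * Cg := fun u x => by
    rw [abs_mul]; exact mul_le_mul (hCg _) (hCg _) (abs_nonneg _) hCg0
  have hEb : ∀ u, |E u| ≤ Cg * Cg := fun u => by
    calc |E u| = ‖∫ x', g (x' u) * g (x' (u + k)) ∂P‖ := (Real.norm_eq_abs _).symm
      _ ≤ Cg * Cg * P.real univ := norm_integral_le_of_norm_le_const (Eventually.of_forall fun x => by
          rw [Real.norm_eq_abs]; exact hAb u x)
      _ = Cg * Cg := by rw [probReal_univ, mul_one]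
  have hBm : ∀ u, Measurable (B u) := fun u => (hAm u).sub measurable_const
  have hBb : ∀ u x, |B u x| ≤ 2 * (Cg * Cg) := fun u x =>
    (abs_sub _ _).trans (by linarith [hAb u x, hEb u])
  have hbias : ∀ u, |E u - c| ≤ 2 * Cg ^ 2 * (1 - ε.toReal) ^ (u / m) := fun u => by
    have h := abs_chain_lagProduct_sub_autocov_le_of_nHit μ₀ hmin hε1 hπ hg hCg u k
    rw [← hP] at h
    exact h
  -- decomposition: average − c = (1/n) Σ B_t + (1/n) Σ (E_t − c)
  set D : ℝ := (∑ t ∈ range n, (E t - c)) / n with hD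
  have hDb : |D| ≤ 2 * Cg ^ 2 * (m / ε.toReal) / n := by
    rw [hD, abs_div, abs_of_pos hn0']
    refine div_le_div_of_nonneg_right ?_ hn0'.le
    calc |∑ t ∈ range n, (E t - c)| ≤ ∑ t ∈ range n, |E t - c| := Finset.abs_sum_le_sum_abs _ _
      _ ≤ ∑ t ∈ range n, 2 * Cg ^ 2 * (1 - ε.toReal) ^ (t / m) := Finset.sum_le_sum fun t _ => hbias t
      _ = 2 * Cg ^ 2 * ∑ t ∈ range n, (1 - ε.toReal) ^ (t / m) := by rw [Finset.mul_sum]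
      _ ≤ 2 * Cg ^ 2 * (m / (1 - (1 - ε.toReal))) :=
          mul_le_mul_of_nonneg_left (Scoring.sum_range_pow_div_le hm hr0 hr1 n) (by positivity)
      _ = 2 * Cg ^ 2 * (m / ε.toReal) := by rw [sub_sub_cancel]
  have hpt : ∀ x : ℕ → S, ((∑ t ∈ range n, g (x t) * g (x (t + k))) / (n : ℝ) - c) ^ 2
      ≤ 2 * ((∑ t ∈ range n, B t x) ^ 2 / (n : ℝ) ^ 2) + 2 * D ^ 2 := by
    intro x
    have hsplit : (∑ t ∈ range n, g (x t) * g (x (t + k))) / (n : ℝ) - c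
        = (∑ t ∈ range n, B t x) / n + D := by
      have hsumB : ∑ t ∈ range n, B t x
          = ∑ t ∈ range n, g (x t) * g (x (t + k)) - ∑ t ∈ range n, E t := by
        simp only [hB, Finset.sum_sub_distrib]
      have hsumD : ∑ t ∈ range n, (E t - c) = ∑ t ∈ range n, E t - n * c := by
        rw [Finset.sum_sub_distrib, Finset.sum_const, Finset.card_range, nsmul_eq_mul]
      rw [hD, hsumB, hsumD]
      field_simp
      ring
    rw [hsplit]
    have h2 : ((∑ t ∈ range n, B t x) / n + D) ^ 2
        ≤ 2 * ((∑ t ∈ range n, B t x) / n) ^ 2 + 2 * D ^ 2 := by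
      nlinarith [sq_nonneg ((∑ t ∈ range n, B t x) / n - D)]
    rwa [div_pow] at h2
  have hSm : Measurable fun x : ℕ → S => (∑ t ∈ range n, B t x) ^ 2 :=
    (Finset.measurable_sum _ fun t _ => hBm t).pow_const 2
  have hSb : ∀ x : ℕ → S, |(∑ t ∈ range n, B t x) ^ 2| ≤ (n * (2 * (Cg * Cg))) ^ 2 := fun x => by
    rw [abs_pow]
    refine pow_le_pow_left₀ (abs_nonneg _) ((Finset.abs_sum_le_sum_abs _ _).trans ?_) 2
    calc ∑ t ∈ range n, |B t x| ≤ ∑ t ∈ range n, 2 * (Cg * Cg) := Finset.sum_le_sum fun t _ => hBb t x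
      _ = n * (2 * (Cg * Cg)) := by rw [Finset.sum_const, Finset.card_range, nsmul_eq_mul]
  have hiS : Integrable (fun x : ℕ → S => (∑ t ∈ range n, B t x) ^ 2) P :=
    Scoring.integrable_of_bounded P hSm hSb
  have hlhs_m : Measurable fun x : ℕ → S =>
      ((∑ t ∈ range n, g (x t) * g (x (t + k))) / (n : ℝ) - c) ^ 2 :=
    (((Finset.measurable_sum _ fun t _ => hAm t).div_const _).sub measurable_const).pow_const 2
  have hvar := chain_sq_sum_lagProduct_centred_le_of_nHit μ₀ hmin hε0 hε1 hm hπ hg hCg k n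
  rw [← hP] at hvar
  calc ∫ x, ((∑ t ∈ range n, g (x t) * g (x (t + k))) / (n : ℝ) - c) ^ 2 ∂P
      ≤ ∫ x, (2 * ((∑ t ∈ range n, B t x) ^ 2 / (n : ℝ) ^ 2) + 2 * D ^ 2) ∂P := by
        refine integral_mono_of_nonneg (ae_of_all _ fun x => sq_nonneg _)
          (((hiS.div_const _).const_mul 2).add (integrable_const _)) (ae_of_all _ hpt)
    _ = 2 * ((∫ x, (∑ t ∈ range n, B t x) ^ 2 ∂P) / (n : ℝ) ^ 2) + 2 * D ^ 2 := by
        rw [integral_add ((hiS.div_const _).const_mul 2) (integrable_const _), integral_const_mul,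
          integral_div, integral_const, probReal_univ, one_smul]
    _ ≤ 2 * ((4 * Cg ^ 4 * (1 + 2 * k + 2 * m / ε.toReal) * n) / (n : ℝ) ^ 2)
        + 2 * (2 * Cg ^ 2 * (m / ε.toReal) / n) ^ 2 := by
        refine add_le_add (mul_le_mul_of_nonneg_left (div_le_div_of_nonneg_right hvar
          (by positivity)) (by norm_num)) (mul_le_mul_of_nonneg_left ?_ (by norm_num))
        exact sq_le_sq' (by linarith [neg_abs_le D, hDb, abs_nonneg D]) ((le_abs_self D).trans hDb)
    _ = (8 * Cg ^ 4 * (1 + 2 * k + 2 * m / ε.toReal) + 8 * Cg ^ 4 * (m / ε.toReal) ^ 2 / n) / n := by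
        field_simp
        ring
    _ ≤ (8 * Cg ^ 4 * (1 + 2 * k + 2 * m / ε.toReal) + 8 * Cg ^ 4 * (m / ε.toReal) ^ 2) / n := by
        refine div_le_div_of_nonneg_right (add_le_add le_rfl ?_) hn0'.le
        exact div_le_self (by positivity) (by exact_mod_cast hn0)
    _ = 8 * Cg ^ 4 * (1 + 2 * k + 2 * m / ε.toReal + (m / ε.toReal) ^ 2) / ((N - k : ℕ) : ℝ) := by
        rw [hn]; ring

end LagSum

end Summit.Ventures.LatticeQCDFlow.Exactness.GeneralNCMC
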